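import Literature.MathematicalPhysics.QuantumFieldTheory.Balaban1983to89.B7Eq170Flat
import Literature.MathematicalPhysics.QuantumFieldTheory.Balaban1983to89.B7Eq167Flat

/-!
# B7 Proposition 8 at the flat background: `u₁u₂ ∈ Λ_k(1, α₃')` and (171)–(175) (`B7Prop8Flat`)

Source: T. Bałaban, *Averaging operations for lattice gauge theories*, Commun. Math. Phys. **98** (1985) 17–51
(`Balaban1985Averaging`, "B7"), Sect. F, pp. 44–45 (renders `1985-cmp98-averaging-p028/p029-x2.png`, READ AS IMAGES by the
typing seat; journal page = render page + 16).

PRINT (verbatim). p. 45: "Let us denote the constant in the above bound by `C₃`, so we have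
`(R̄₀v)(y) = (R̄₀v₁)(y)(R̄₀v₂)(y)e^{ir̄(y)}, |r̄(y)| < c₁ + C₃(c₁ + c₂)², y ∈ Ω'^{(1)}`. (170)
Now let us take two gauge transformations `u₁, u₂` satisfying (166), (167). Applying the above result to `u = u₁u₂`, we get
`(R̄₀u)(x₁) = (R̄₀u₁)(x₁)(R̄₀u₂)(x₁)e^{ir₁(x₁)}, |r₁(x₁)| < C₃(α₃Lη)²` (171) for `x₁ ∈ Ω^{(1)}`. Next applying it to
`R̄₀u, R̄₀u₁, R̄₀u₂`, we get `(R̄₀u²)(x₂) = (R̄₀u₁²)(x₂)(R̄₀u₂²)(x₂)e^{ir₂(x₂)},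
|r₂(x₂)| < C₃(α₃Lη)² + C₃(C₃(α₃Lη)² + α₃L²η)² ≦ C₃(α₃L²η)²[1 + L^{−2}(1 + C₃α₃)²]` (172) for `x₂ ∈ Ω^{(2)}`. We can prove
by an easy induction that `(R̄₀uʲ)(x_j) = (R̄₀u₁ʲ)(x_j)(R̄₀u₂ʲ)(x_j)e^{ir_j(x_j)}, x_j ∈ Ω^{(j)},
|r_j(x_j)| < C₃(α₃Lʲη)²[1 + L^{−2}(1 + C₃α₃)² + … + (L^{−2}(1 + C₃α₃)²)^{j−1}] < 2C₃(α₃Lʲη)²` (173) for `α₃` sufficiently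
small, i.e., such that `L^{−2}(1 + C₃α₃)² ≦ ½`. From this it follows that
`|(R̄₀uʲ)(x_j) − 1| < 2α₃ + 2C₃(α₃Lʲη)² ≦ 2α₃ + 2C₃α₃², j = 0, 1, …, k,
|(R̄₀uʲ)⁻¹(x_{j+1})(R̄ʲ_{0,x_{j+1}}R̄₀uʲ)(x_j) − 1| < 2α₃L^{j+1}η + 4C₃(α₃Lʲη)² < (2α₃ + 2C₃α₃²)L^{j+1}η, j = 0, 1, …, k − 1`. (175)
We can formulate these results in **Proposition 8.** If `u₁, u₂ ∈ Λ_k(U₀, α₃)` and `α₃` is sufficiently small, i.e., `α₃ ≦ c₆`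
for some `c₆`, then `u = u₁u₂ ∈ Λ_k(U₀, 2α₃ + 2C₃α₃²)` and we have (173)."

WHAT IS TYPED. The flat-background case `U₀ = 1` of Proposition 8 and of (171)–(175), as KERNEL THEOREMS over the concrete
model of this package (`𝔸` a complete normed `ℂ`-algebra, gauge transformations `u : ℤ^d → 𝔸ˣ`, `B7Eq84Concrete.uavg L 1 u j`
= `\overline{R₀u}ʲ`, `B7Eq167Flat.InLambda L 1 u k α₃ η` = "`u ∈ Λ_k(1, α₃)`" ((166) ∧ (167), `≤` for `<`, free `η`)), on
top of the kernel product lemma `B7Eq170Flat.eq170_flat'` ((170) with the explicit `C₃ = 1116`):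
* §1 `cond167_one_left_iff` — (167) at `U₀ = 1` is literally the hypothesis "`|v_i⁻¹(y)(R_{0,y}v_i)(x) − 1| < c₂`" of the
  product lemma with `y = Lx_{j+1}`, `c₂ = α₃L^{j+1}η`; `uavg_mul_zero` — `r₀ = 0`.
* §2 `eq173_flat` — **(171)–(173)**: for `u₁, u₂ ∈ Λ_k(1, α₃)`, `L ≥ 2`, `0 ≤ η`, `0 ≤ α₃ ≤ 1/5`, `α₃L^kη ≤ 1/3000`, every
  `j ≤ k` has an `r_j : ℤ^d → 𝔸` with `ūʲ = ū₁ʲū₂ʲe^{r_j}` and `‖r_j‖ ≤ 2·1116·(α₃Lʲη)²`, built by the printed induction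
  (`r_{j+1}(x_{j+1}) = r̄(Lx_{j+1})` of (169)–(170) for `v_i = ū_iʲ`, `r = r_j`); the arithmetic of the step is `step173_arith`.
* §3 `cond166_mul`, `cond167_mul`, **`prop8_flat`** — (175) and Proposition 8 at `U₀ = 1` with the explicit `c₆ = 1/3000`
  (given `L^kη ≤ 1`; print `η = L^{−k}`): `u₁u₂ ∈ Λ_k(1, 6α₃ + 8928α₃²)` (`prop8_flat'`: `⊆ Λ_k(1, 10α₃)`).

READINGS (recorded in `DIVERGENCE.md` D-b07g20.4; none is an objection to print).
(a) BANACH READING of `|·|`: print's values are unitary, so `|ab − 1| ≤ |a − 1| + |b − 1|`, `|e^{ir} − 1| ≤ |r|`,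
    `|R(v)X| = |X|`; here `1 + ‖ab − 1‖ ≤ (1 + ‖a − 1‖)(1 + ‖b − 1‖)` (`B7Eq167Flat.norm_mul_sub_one_le_exp`), `‖e^{r} − 1‖ ≤ e^{‖r‖} − 1`,
    conjugation by `v` with `‖v^{±1} − 1‖ ≤ 2/5` costs a factor `2` (`B7Eq170Flat.norm_cj_le_two_mul`), and `eˣ − 1 ≤ 2x`
    (`x ≤ 1`); whence print's `2α₃ + 2C₃α₃²` (`C₃ = 1116`: `2α₃ + 2232α₃²`) becomes `4α₃ + 4464α₃²` in (175) line 1 and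
    `6α₃ + 8928α₃²` in (175) line 2 / Proposition 8. The STRUCTURE (linear + `C₃`-quadratic in `α₃`, scale factor `L^{j+1}η`,
    phase `r_j = O((α₃Lʲη)²)`) is print's.
(b) EXPLICIT SMALLNESS: print's "`α₃ ≤ c₆`", "`L^{−2}(1 + C₃α₃)² ≦ ½`" is replaced by `0 ≤ α₃ ≤ 1/3000` (with `L ≥ 2`,
    `L^kη ≤ 1`); `eq173_flat` itself only needs `α₃ ≤ 1/5` and `α₃L^kη ≤ 1/3000`.
(c) INDUCTION INVARIANT: print carries the geometric bracket `1 + q + … + q^{j−1}`, `q = L^{−2}(1 + C₃α₃)²`, and bounds it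
    by `2`; the kernel induction carries the final form `‖r_j‖ ≤ 2C₃(α₃Lʲη)²` directly: the step is
    `2C₃b² + C₃(2C₃b² + a)² ≤ 2C₃a²` for `a = α₃L^{j+1}η = Lb`, `L ≥ 2`, `a ≤ 1/3000` (`step173_arith`). Print's own bracket
    manipulation in (172)/(173) silently uses `η ≤ L^{−2}` resp. `L^{j−1}η ≤ L^{−2}` (true for `η = L^{−k}`, `j ≤ k − 1`) —
    recorded as INFO in `GAPS.md` C-b07g20-6, not a gap.
(d) FLAT BACKGROUND ONLY: at `U₀ = 1` the rotations `R̄ʲ_{0,x_{j+1}}` are the identity (`avgIter_one`, `hol_one`) and (108)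
    is void; print's proof (pp. 44–45) is written for a general background `V₀` and is verbatim the same there because
    rotations by unitaries are isometries — in the Banach reading the curved case would need the (108)-machinery of
    Props 3–6 at `U₀`, which this package has only at `U₀ = 1` (`B7Prop6Flat`). The hand certification of the general case
    is `GAPS.md` C-adv4-24; the schematic printed statement is `B7.Prop8Printed` / `B7.ineq173_recursion` (by name, not
    instantiated here: different interface).
(e) `η` is a free parameter with `L^kη ≤ 1` (print `η = L^{−k}`), as in `B7Eq167Flat`.
(f) `≤` for `<` throughout, as in the whole package.

DECLARATIONS (11 theorems, 0 definitions; imports `B7Eq170Flat`, `B7Eq167Flat` only): `cond167_one_left_iff`,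
`expUnit_zero`, `uavg_mul_zero`, `step173_arith`, `eq173_flat`, `pow_eta_le`, `one_add_norm_le_exp`, `cond166_mul`,
`cond167_mul`, `prop8_flat`, `prop8_flat'`. Reused BY NAME (not restated): `B7Eq170Flat.eq170_flat'`, `eq168_factor`,
`vprod`, `rbar`, `cj_sub_one`, `val_Rc_eq_cj`, `norm_cj_le_two_mul`; `B7Eq167Flat.InLambda`, `Cond166`, `Cond167`,
`InLambda.mono`, `norm_mul_sub_one_le_exp`, `exp_sub_one_le_two_mul_of_le`; `B7Eq84Concrete.uavg_succ_one_left`;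
`B7Eq92Concrete.avgIter_one`, `Rc_one_apply`; `B8Ineq130.hol_one`; `B7Prop6Flat.norm_units_inv_sub_one_le`;
`B7Transfer.norm_exp_sub_one_le_of_le`.

[cite: Balaban1985Averaging, Proposition 8 p.45, (171)–(175) p.45, (166)–(170) pp.44–45, (78)–(80) p.30]
-/

noncomputable section

open NormedSpace Finset

namespace Literature.MathematicalPhysics.QuantumFieldTheory.Balaban1983to89.B7Prop8Flat

open B7Prop1Explicit MatrixLog B7Eq92Concrete B7Eq99Concrete B7Eq84Concrete B7Eq167Flat B7Eq170Flat
open B8Ineq130 (hol_one)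
open B7Prop6Flat (norm_units_inv_sub_one_le)

export B7Prop1Explicit (Site)

variable {d : ℕ}
variable {𝔸 : Type*} [NormedRing 𝔸] [NormedAlgebra ℂ 𝔸] [CompleteSpace 𝔸]

/-! ## §1 The conditions (166), (167) at `U₀ = 1` and the level-`0` data -/

/-- **(167) at the flat background**: with `U₀ = 1` all averaged backgrounds are `1` (`avgIter_one`), the transporter is `1`
(`hol_one`) and `R(1) = id`, so (167) reads `‖(ūʲ)⁻¹(Lx_{j+1})·ūʲ(Lx_{j+1} + r) − 1‖ ≤ α₃L^{j+1}η` — exactly the hypothesis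
"`|v_i⁻¹(y)(R_{0,y}v_i)(x) − 1| < c₂`" of the product lemma p. 44 with `y = Lx_{j+1}`, `c₂ = α₃L^{j+1}η`.
[cite: Balaban1985Averaging, (167) p.44, (79)–(80) p.30] -/
theorem cond167_one_left_iff (L : ℕ) (u : Site d → 𝔸ˣ) (k : ℕ) (α₃ η : ℝ) :
    Cond167 L (1 : Site d → Fin d → 𝔸ˣ) u k α₃ η ↔
      ∀ j < k, ∀ (z : Site d) (r : Fin d → Fin L),
        ‖((((uavg L 1 u j ((L : ℤ) • z))⁻¹ * uavg L 1 u j ((L : ℤ) • z + boxVec L r) : 𝔸ˣ)) : 𝔸) - 1‖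
          ≤ α₃ * (L : ℝ) ^ (j + 1) * η := by
  simp only [Cond167, avgIter_one, hol_one, Rc_one_apply]

/-- `e^{0} = 1` in the group of units. [folklore] -/
theorem expUnit_zero : expUnit (0 : 𝔸) = 1 := by
  ext; simp [val_expUnit]

/-- At level `0`: `ū⁰ = u = u₁u₂ = ū₁⁰ū₂⁰e^{i·0}` (`r₀ = 0`). [cite: Balaban1985Averaging, (79) p.30, (171) p.45] -/
theorem uavg_mul_zero (L : ℕ) (u₁ u₂ : Site d → 𝔸ˣ) :
    uavg L (1 : Site d → Fin d → 𝔸ˣ) (u₁ * u₂) 0 = vprod (uavg L 1 u₁ 0) (uavg L 1 u₂ 0) (fun _ => (0 : 𝔸)) := by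
  funext x
  simp only [uavg_zero, Pi.mul_apply, vprod_apply, expUnit_zero, mul_one]

/-! ## §2 (171)–(173): `ūʲ = ū₁ʲ ū₂ʲ e^{ir_j}`, `|r_j(x_j)| < 2C₃(α₃Lʲη)²` -/

/-- The arithmetic of the induction step (172)→(173) with `C₃ = 1116`: if `|r_j| ≤ 2C₃b²` (`b = α₃Lʲη`), the product lemma
gives `|r_{j+1}| ≤ c₁ + C₃(c₁ + c₂)²` with `c₁ = 2C₃b²`, `c₂ = a = α₃L^{j+1}η = L·b`, and for `L ≥ 2`, `a ≤ 1/3000` this is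
`≤ 2C₃a²` (print: "`|r_j(x_j)| < C₃(α₃Lʲη)²[1 + L^{−2}(1 + C₃α₃)² + …] < 2C₃(α₃Lʲη)²` for `L^{−2}(1 + C₃α₃)² ≤ ½`").
[cite: Balaban1985Averaging, (171)–(173) p.45] -/
theorem step173_arith {a b c₁ L : ℝ} (hL : 2 ≤ L) (hb : 0 ≤ b) (hab : a = L * b) (ha : a ≤ 1 / 3000)
    (hc₁0 : 0 ≤ c₁) (hc₁ : c₁ ≤ 2 * 1116 * b ^ 2) :
    c₁ + 1116 * (c₁ + a) ^ 2 ≤ 2 * 1116 * a ^ 2 := by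
  have ha0 : 0 ≤ a := by rw [hab]; positivity
  have hb2 : 4 * b ^ 2 ≤ a ^ 2 := by
    rw [hab, mul_pow]; exact mul_le_mul_of_nonneg_right (by nlinarith) (sq_nonneg b)
  have hc₁' : c₁ ≤ 558 * a ^ 2 := by linarith
  have h1 : c₁ + a ≤ a * (1 + 558 * a) := by nlinarith
  have h2 : 0 ≤ c₁ + a := by linarith
  have h3 : (c₁ + a) ^ 2 ≤ (a * (1 + 558 * a)) ^ 2 := pow_le_pow_left₀ h2 h1 2
  have h4 : (1 + 558 * a) ^ 2 ≤ 3 / 2 := by nlinarith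
  nlinarith [mul_le_mul_of_nonneg_left h4 (sq_nonneg a)]

variable {L : ℕ} {u₁ u₂ : Site d → 𝔸ˣ} {k : ℕ} {α₃ η : ℝ}

/-- **(171)–(173) at the flat background, kernel form** ("We can prove by an easy induction that
`(R̄₀uʲ)(x_j) = (R̄₀u₁ʲ)(x_j)(R̄₀u₂ʲ)(x_j)e^{ir_j(x_j)}, x_j ∈ Ω^{(j)}, |r_j(x_j)| < … < 2C₃(α₃Lʲη)²` (173)"): for
`u₁, u₂ ∈ Λ_k(1, α₃)` (`B7Eq167Flat.InLambda`, parameter `η`), `L ≥ 2`, `0 ≤ η`, `0 ≤ α₃ ≤ 1/5` and `α₃L^kη ≤ 1/3000`, every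
`j ≤ k` admits `r_j : ℤ^d → 𝔸` with `ūʲ = ū₁ʲū₂ʲe^{r_j}` (`u = u₁u₂`, `ūʲ = B7Eq84Concrete.uavg L 1 u j`) and
`‖r_j‖ ≤ 2·1116·(α₃Lʲη)²`; `r₀ = 0` and `r_{j+1}(x_{j+1}) = r̄(Lx_{j+1})` is the `r̄` of (169)–(170) (`B7Eq170Flat.rbar`) for
`v_i = ū_iʲ`, `r = r_j`, `c₁ = 2·1116(α₃Lʲη)²`, `c₂ = α₃L^{j+1}η`. [cite: Balaban1985Averaging, (171)–(173) p.45, (170) p.45] -/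
theorem eq173_flat (hL : 2 ≤ L) (hη : 0 ≤ η) (hα0 : 0 ≤ α₃) (hα : α₃ ≤ 1 / 5)
    (ht : α₃ * (L : ℝ) ^ k * η ≤ 1 / 3000)
    (h₁ : InLambda L (1 : Site d → Fin d → 𝔸ˣ) u₁ k α₃ η) (h₂ : InLambda L (1 : Site d → Fin d → 𝔸ˣ) u₂ k α₃ η) :
    ∀ j ≤ k, ∃ r : Site d → 𝔸,
      uavg L (1 : Site d → Fin d → 𝔸ˣ) (u₁ * u₂) j = vprod (uavg L 1 u₁ j) (uavg L 1 u₂ j) r ∧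
        ∀ z, ‖r z‖ ≤ 2 * 1116 * (α₃ * (L : ℝ) ^ j * η) ^ 2 := by
  have hL1 : 1 ≤ L := le_trans (by norm_num) hL
  have hLr : (1 : ℝ) ≤ L := by exact_mod_cast hL1
  have hLr2 : (2 : ℝ) ≤ L := by exact_mod_cast hL
  have h167₁ := (cond167_one_left_iff L u₁ k α₃ η).1 h₁.2
  have h167₂ := (cond167_one_left_iff L u₂ k α₃ η).1 h₂.2
  have h166₂ := h₂.1
  -- `α₃ L^j η ≤ α₃ L^k η` for `j ≤ k`
  have hmono : ∀ j ≤ k, α₃ * (L : ℝ) ^ j * η ≤ α₃ * (L : ℝ) ^ k * η := fun j hj =>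
    mul_le_mul_of_nonneg_right (mul_le_mul_of_nonneg_left (pow_le_pow_right₀ hLr hj) hα0) hη
  intro j
  induction j with
  | zero =>
    intro _
    exact ⟨fun _ => 0, uavg_mul_zero L u₁ u₂, fun z => by rw [norm_zero]; positivity⟩
  | succ j ih =>
    intro hjk
    obtain ⟨r, hE, hB⟩ := ih (Nat.le_of_succ_le hjk)
    have hjlt : j < k := Nat.lt_of_succ_le hjk
    set b : ℝ := α₃ * (L : ℝ) ^ j * η with hb
    set a : ℝ := α₃ * (L : ℝ) ^ (j + 1) * η with ha
    have hb0 : 0 ≤ b := by rw [hb]; positivity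
    have hab : a = (L : ℝ) * b := by rw [ha, hb, pow_succ]; ring
    have ha' : a ≤ 1 / 3000 := (hmono (j + 1) hjk).trans ht
    have hbk : b ≤ 1 / 3000 := (hmono j hjlt.le).trans ht
    set c₁ : ℝ := 2 * 1116 * b ^ 2 with hc₁
    have hc₁0 : 0 ≤ c₁ := by rw [hc₁]; positivity
    have hc₁s : c₁ ≤ 1 / 400 := by rw [hc₁]; nlinarith
    have hc₂s : a ≤ 1 / 400 := by linarith
    -- the new phase: `r_{j+1}(z) := r̄(Lz)` of (169)–(170) for `v_i = ū_iʲ`, `r = r_j`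
    refine ⟨fun z => rbar L (uavg L 1 u₁ j) (uavg L 1 u₂ j) r ((L : ℤ) • z), ?_, ?_⟩
    · funext z
      have hy := fun (z : Site d) => (eq170_flat' (L := L) (v₁ := uavg L 1 u₁ j) (v₂ := uavg L 1 u₂ j) (R := r)
        (y := (L : ℤ) • z) (c₁ := c₁) (c₂ := a) (hB _) (fun r' => hB _) (fun r' => h167₁ j hjlt z r')
        (fun r' => h167₂ j hjlt z r')
        ((norm_units_inv_sub_one_le _ ((h166₂ j hjlt.le _).trans (by linarith))).trans
          (by linarith [h166₂ j hjlt.le ((L : ℤ) • z)]))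
        ((h166₂ j hjlt.le _).trans (by linarith)) hL1 hc₁s hc₂s)
      rw [uavg_succ_one_left, hE, (hy z).1, vprod_apply, uavg_succ_one_left, uavg_succ_one_left]
    · intro z
      have hy := (eq170_flat' (L := L) (v₁ := uavg L 1 u₁ j) (v₂ := uavg L 1 u₂ j) (R := r)
        (y := (L : ℤ) • z) (c₁ := c₁) (c₂ := a) (hB _) (fun r' => hB _) (fun r' => h167₁ j hjlt z r')
        (fun r' => h167₂ j hjlt z r')
        ((norm_units_inv_sub_one_le _ ((h166₂ j hjlt.le _).trans (by linarith))).trans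
          (by linarith [h166₂ j hjlt.le ((L : ℤ) • z)]))
        ((h166₂ j hjlt.le _).trans (by linarith)) hL1 hc₁s hc₂s).2
      exact hy.trans (step173_arith hLr2 hb0 hab ha' hc₁0 le_rfl)

/-! ## §3 (175) and Proposition 8: `u₁u₂ ∈ Λ_k(1, α₃')` -/

/-- `(Lʲη)² ≤ L^{j+1}η` and `Lʲη ≤ 1` for `j ≤ k` when `L ≥ 1`, `0 ≤ η`, `L^kη ≤ 1` (print: `η = L^{−k}`). [folklore] -/
theorem pow_eta_le (hL : 1 ≤ L) (hη : 0 ≤ η) (hk : (L : ℝ) ^ k * η ≤ 1) {j : ℕ} (hj : j ≤ k) :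
    (L : ℝ) ^ j * η ≤ 1 ∧ ((L : ℝ) ^ j * η) ^ 2 ≤ (L : ℝ) ^ (j + 1) * η := by
  have hLr : (1 : ℝ) ≤ L := by exact_mod_cast hL
  have h1 : (L : ℝ) ^ j * η ≤ 1 :=
    (mul_le_mul_of_nonneg_right (pow_le_pow_right₀ hLr hj) hη).trans hk
  have h0 : 0 ≤ (L : ℝ) ^ j * η := by positivity
  refine ⟨h1, ?_⟩
  calc ((L : ℝ) ^ j * η) ^ 2 = ((L : ℝ) ^ j * η) * ((L : ℝ) ^ j * η) := sq _
    _ ≤ 1 * ((L : ℝ) ^ j * η) := mul_le_mul_of_nonneg_right h1 h0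
    _ ≤ (L : ℝ) ^ (j + 1) * η := by
      rw [one_mul]; exact mul_le_mul_of_nonneg_right (pow_le_pow_right₀ hLr (Nat.le_succ j)) hη

omit [NormedAlgebra ℂ 𝔸] [CompleteSpace 𝔸] in
/-- Bookkeeping: `‖w − 1‖ ≤ eᵖ − 1 ⇒ 1 + ‖w − 1‖ ≤ eᵖ`. [folklore] -/
theorem one_add_norm_le_exp {w : 𝔸} {p : ℝ} (h : ‖w - 1‖ ≤ Real.exp p - 1) : 1 + ‖w - 1‖ ≤ Real.exp p := by
  linarith

/-- **(175), first line, at the flat background** ("`|(R̄₀uʲ)(x_j) − 1| < 2α₃ + 2C₃(α₃Lʲη)² ≦ 2α₃ + 2C₃α₃², j = 0, 1, …, k`"):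
in the Banach reading `‖ū₁ʲū₂ʲe^{r_j} − 1‖ ≤ e^{2α₃ + ‖r_j‖} − 1 ≤ 2(2α₃ + 2·1116·α₃²) = 4α₃ + 4464α₃²` for `u₁, u₂ ∈ Λ_k(1, α₃)`,
`L ≥ 2`, `0 ≤ η`, `L^kη ≤ 1`, `0 ≤ α₃ ≤ 1/3000` (print's unitary bookkeeping `|ab − 1| ≤ |a − 1| + |b − 1|`, `|e^{ir} − 1| ≤ |r|`
is replaced by `1 + ‖ab − 1‖ ≤ (1 + ‖a − 1‖)(1 + ‖b − 1‖)` and `e^x − 1 ≤ 2x`, whence the factor `2`).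
[cite: Balaban1985Averaging, (175) p.45, (173) p.45, (166) p.44] -/
theorem cond166_mul (hL : 2 ≤ L) (hη : 0 ≤ η) (hk : (L : ℝ) ^ k * η ≤ 1) (hα0 : 0 ≤ α₃) (hα : α₃ ≤ 1 / 3000)
    (h₁ : InLambda L (1 : Site d → Fin d → 𝔸ˣ) u₁ k α₃ η) (h₂ : InLambda L (1 : Site d → Fin d → 𝔸ˣ) u₂ k α₃ η) :
    Cond166 L (1 : Site d → Fin d → 𝔸ˣ) (u₁ * u₂) k (4 * α₃ + 4464 * α₃ ^ 2) := by
  have hL1 : 1 ≤ L := le_trans (by norm_num) hL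
  have ht : α₃ * (L : ℝ) ^ k * η ≤ 1 / 3000 := by
    rw [mul_assoc]; exact (mul_le_of_le_one_right hα0 hk).trans hα
  intro j hj z
  obtain ⟨r, hE, hB⟩ := eq173_flat hL hη hα0 (hα.trans (by norm_num)) ht h₁ h₂ j hj
  obtain ⟨hj1, -⟩ := pow_eta_le hL1 hη hk hj
  have hb1 : α₃ * (L : ℝ) ^ j * η ≤ α₃ := by
    rw [mul_assoc]; exact mul_le_of_le_one_right hα0 hj1
  have hb0 : 0 ≤ α₃ * (L : ℝ) ^ j * η := by positivity
  have hρ : 2 * 1116 * (α₃ * (L : ℝ) ^ j * η) ^ 2 ≤ 2232 * α₃ ^ 2 := by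
    nlinarith [pow_le_pow_left₀ hb0 hb1 2]
  rw [hE, vprod_apply, Units.val_mul, Units.val_mul, val_expUnit]
  have f1 : 1 + ‖((uavg L 1 u₁ j z : 𝔸ˣ) : 𝔸) - 1‖ ≤ Real.exp α₃ := by
    linarith [h₁.1 j hj z, Real.add_one_le_exp α₃]
  have f2 : 1 + ‖((uavg L 1 u₂ j z : 𝔸ˣ) : 𝔸) - 1‖ ≤ Real.exp α₃ := by
    linarith [h₂.1 j hj z, Real.add_one_le_exp α₃]
  have f3 : 1 + ‖exp (r z) - 1‖ ≤ Real.exp (2 * 1116 * (α₃ * (L : ℝ) ^ j * η) ^ 2) := by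
    linarith [B7Transfer.norm_exp_sub_one_le_of_le (r z) (hB z)]
  refine (norm_mul_sub_one_le_exp (one_add_norm_le_exp (norm_mul_sub_one_le_exp f1 f2)) f3).trans ?_
  have := exp_sub_one_le_two_mul_of_le (x := α₃ + α₃ + 2 * 1116 * (α₃ * (L : ℝ) ^ j * η) ^ 2)
    (y := 2 * α₃ + 2232 * α₃ ^ 2) (by positivity) (by linarith) (by nlinarith)
  linarith

/-- **(175), second line, at the flat background** ("`|(R̄₀uʲ)⁻¹(x_{j+1})(Rʲ_{0,x_{j+1}}R̄₀uʲ)(x_j) − 1| < 2α₃L^{j+1}η + 4C₃(α₃Lʲη)² < (2α₃ + 2C₃α₃²)L^{j+1}η,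
thus `u₁u₂ ∈ Λ_k(U₀, 2α₃ + 2C₃α₃²)`"): by (168) (`B7Eq170Flat.eq168_factor`) the quantity of (167) for `u = u₁u₂` is
`e^{−r_j(y)}·[ū₂ʲ(y)⁻¹ A₁ ū₂ʲ(y)]·A₂·e^{r_j(x)}` with `‖A_i − 1‖ ≤ α₃L^{j+1}η`, `‖r_j‖ ≤ 2·1116(α₃Lʲη)²`; in the Banach reading
(conjugation costs a factor `2`, products are bounded multiplicatively, `e^x − 1 ≤ 2x`) this gives
`‖… − 1‖ ≤ 2(3α₃L^{j+1}η + 4·1116(α₃Lʲη)²) ≤ (6α₃ + 8928α₃²)L^{j+1}η` (using `(Lʲη)² ≤ L^{j+1}η`).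
[cite: Balaban1985Averaging, (175) p.45, (167)–(168) p.44] -/
theorem cond167_mul (hL : 2 ≤ L) (hη : 0 ≤ η) (hk : (L : ℝ) ^ k * η ≤ 1) (hα0 : 0 ≤ α₃) (hα : α₃ ≤ 1 / 3000)
    (h₁ : InLambda L (1 : Site d → Fin d → 𝔸ˣ) u₁ k α₃ η) (h₂ : InLambda L (1 : Site d → Fin d → 𝔸ˣ) u₂ k α₃ η) :
    Cond167 L (1 : Site d → Fin d → 𝔸ˣ) (u₁ * u₂) k (6 * α₃ + 8928 * α₃ ^ 2) η := by
  have hL1 : 1 ≤ L := le_trans (by norm_num) hL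
  have ht : α₃ * (L : ℝ) ^ k * η ≤ 1 / 3000 := by
    rw [mul_assoc]; exact (mul_le_of_le_one_right hα0 hk).trans hα
  have h167₁ := (cond167_one_left_iff L u₁ k α₃ η).1 h₁.2
  have h167₂ := (cond167_one_left_iff L u₂ k α₃ η).1 h₂.2
  rw [cond167_one_left_iff]
  intro j hj z r'
  obtain ⟨r, hE, hB⟩ := eq173_flat hL hη hα0 (hα.trans (by norm_num)) ht h₁ h₂ j hj.le
  obtain ⟨hj1, hsq⟩ := pow_eta_le hL1 hη hk hj.le
  obtain ⟨hj1', -⟩ := pow_eta_le hL1 hη hk (Nat.succ_le_of_lt hj)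
  -- abbreviations
  set y : Site d := (L : ℤ) • z with hy
  set x : Site d := (L : ℤ) • z + boxVec L r' with hx
  set b : ℝ := α₃ * (L : ℝ) ^ j * η with hb
  set a : ℝ := α₃ * (L : ℝ) ^ (j + 1) * η with ha
  have hb0 : 0 ≤ b := by rw [hb]; positivity
  have ha0 : 0 ≤ a := by rw [ha]; positivity
  have ha1 : a ≤ α₃ := by rw [ha, mul_assoc]; exact mul_le_of_le_one_right hα0 hj1'
  have hb2 : b ^ 2 ≤ α₃ ^ 2 * ((L : ℝ) ^ (j + 1) * η) := by
    rw [hb, mul_assoc, mul_pow]; exact mul_le_mul_of_nonneg_left hsq (sq_nonneg α₃)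
  -- the factorisation (168)
  rw [hE, eq168_factor, Units.val_mul, Units.val_mul, Units.val_mul, val_expUnit, val_expUnit, val_Rc_eq_cj]
  -- the four factors
  have hw : ‖(((uavg L 1 u₂ j y)⁻¹ : 𝔸ˣ) : 𝔸) - 1‖ ≤ 2 / 5 :=
    (norm_units_inv_sub_one_le _ ((h₂.1 j hj.le y).trans (by linarith))).trans (by linarith [h₂.1 j hj.le y])
  have hw' : ‖((uavg L 1 u₂ j y : 𝔸ˣ) : 𝔸) - 1‖ ≤ 2 / 5 := (h₂.1 j hj.le y).trans (by linarith)
  have f1 : 1 + ‖exp (-r y) - 1‖ ≤ Real.exp (2 * 1116 * b ^ 2) := by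
    linarith [B7Transfer.norm_exp_sub_one_le_of_le (-r y) ((norm_neg (r y)).le.trans (hB y))]
  have f2 : 1 + ‖cj (uavg L 1 u₂ j y)⁻¹ ((((uavg L 1 u₁ j y)⁻¹ * uavg L 1 u₁ j x : 𝔸ˣ)) : 𝔸) - 1‖
      ≤ Real.exp (2 * a) := by
    rw [cj_sub_one]
    have := norm_cj_le_two_mul hw (by rw [inv_inv]; exact hw')
      (((((uavg L 1 u₁ j y)⁻¹ * uavg L 1 u₁ j x : 𝔸ˣ)) : 𝔸) - 1)
    linarith [h167₁ j hj z r', Real.add_one_le_exp (2 * a)]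
  have f3 : 1 + ‖((((uavg L 1 u₂ j y)⁻¹ * uavg L 1 u₂ j x : 𝔸ˣ)) : 𝔸) - 1‖ ≤ Real.exp a := by
    linarith [h167₂ j hj z r', Real.add_one_le_exp a]
  have f4 : 1 + ‖exp (r x) - 1‖ ≤ Real.exp (2 * 1116 * b ^ 2) := by
    linarith [B7Transfer.norm_exp_sub_one_le_of_le (r x) (hB x)]
  refine (norm_mul_sub_one_le_exp (one_add_norm_le_exp (norm_mul_sub_one_le_exp
    (one_add_norm_le_exp (norm_mul_sub_one_le_exp f1 f2)) f3)) f4).trans ?_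
  have hb2' : b ^ 2 ≤ α₃ ^ 2 := hb2.trans (mul_le_of_le_one_right (sq_nonneg _) hj1')
  have := exp_sub_one_le_two_mul_of_le (x := 2 * 1116 * b ^ 2 + 2 * a + a + 2 * 1116 * b ^ 2)
    (y := 3 * a + 4464 * b ^ 2) (by positivity) (by linarith) (by nlinarith)
  have hfin : 2 * (3 * a + 4464 * b ^ 2) ≤ (6 * α₃ + 8928 * α₃ ^ 2) * (L : ℝ) ^ (j + 1) * η := by
    rw [ha]; nlinarith
  linarith

/-- **Proposition 8 at the flat background, kernel form.** Print (p. 45): "If `u₁, u₂ ∈ Λ_k(U₀, α₃)` and `α₃` is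
sufficiently small, i.e., `α₃ ≦ c₆` for some `c₆`, then `u = u₁u₂ ∈ Λ_k(U₀, 2α₃ + 2C₃α₃²)` and we have (173)." At `U₀ = 1`
((173) is `eq173_flat`), in the Banach reading of
`Λ_k` (`B7Eq167Flat.InLambda`, `≤` for `<`, free `η` with `L^kη ≤ 1`; print `η = L^{−k}`), with `C₃ = 1116`
(`B7Eq170Flat.eq170_flat'`), `L ≥ 2` and the explicit smallness `0 ≤ α₃ ≤ 1/3000`:
`u₁u₂ ∈ Λ_k(1, 6α₃ + 8928α₃²)` — print's `2α₃ + 2C₃α₃² = 2α₃ + 2232α₃²` up to the Banach bookkeeping factors recorded at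
`cond166_mul`, `cond167_mul`. [cite: Balaban1985Averaging, Proposition 8 p.45, (166)–(175) pp.44–45] -/
theorem prop8_flat (hL : 2 ≤ L) (hη : 0 ≤ η) (hk : (L : ℝ) ^ k * η ≤ 1) (hα0 : 0 ≤ α₃) (hα : α₃ ≤ 1 / 3000)
    (h₁ : InLambda L (1 : Site d → Fin d → 𝔸ˣ) u₁ k α₃ η) (h₂ : InLambda L (1 : Site d → Fin d → 𝔸ˣ) u₂ k α₃ η) :
    InLambda L (1 : Site d → Fin d → 𝔸ˣ) (u₁ * u₂) k (6 * α₃ + 8928 * α₃ ^ 2) η := by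
  refine ⟨fun j hj z => (cond166_mul hL hη hk hα0 hα h₁ h₂ j hj z).trans (by nlinarith), ?_⟩
  exact cond167_mul hL hη hk hα0 hα h₁ h₂

/-- `prop8_flat` with a linear constant: `6α₃ + 8928α₃² ≤ 10α₃` for `α₃ ≤ 1/3000`, so `u₁u₂ ∈ Λ_k(1, 10α₃)`.
[cite: Balaban1985Averaging, Proposition 8 p.45] -/
theorem prop8_flat' (hL : 2 ≤ L) (hη : 0 ≤ η) (hk : (L : ℝ) ^ k * η ≤ 1) (hα0 : 0 ≤ α₃) (hα : α₃ ≤ 1 / 3000)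
    (h₁ : InLambda L (1 : Site d → Fin d → 𝔸ˣ) u₁ k α₃ η) (h₂ : InLambda L (1 : Site d → Fin d → 𝔸ˣ) u₂ k α₃ η) :
    InLambda L (1 : Site d → Fin d → 𝔸ˣ) (u₁ * u₂) k (10 * α₃) η :=
  (prop8_flat hL hη hk hα0 hα h₁ h₂).mono (by nlinarith) le_rfl (by positivity) hη


end Literature.MathematicalPhysics.QuantumFieldTheory.Balaban1983to89.B7Prop8Flat
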